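import Mathlib
import HarnessLib
import Literature.Probability.LatticeModels.IsingLimitLaw
import Literature.Probability.LatticeModels.IsingLimitLawTilt
import Literature.Probability.LatticeModels.IsingLimitLawLaplace
import Literature.Analysis.Complex.PolyaBesselKernel
import Summits.RiemannHypothesis.RiemannHypothesis.Theorems.LeeYangLeeyangPolyaKernelIsingLimitDefs

/-!
# The continuum solution: stub `stub_solution` of the line `telegraph-bessel-chain`
(crux stmt-RiemannHypothesis-0453, `…Theses.LeeYang.LeeyangPolyaKernelIsingLimit`, line Sketch)

Notation: `v = ae^t`, `G_n(v, w) = polyaG n v w = ∫ cosh(s)^n e^{−v cosh s} e^{iws} ds`,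
`h = G₀(v,0) > 0`, `h₁ = G₁(v,0)` (real), `N = G₀(v,y) h₁ − G₁(v,y) h`; the objects of
`…LeeYangLeeyangPolyaKernelIsingLimitDefs` are `S = solS a y = 2G₀(v,y)/h`,
`D = solD a y = (2iv/y) N/h²`, `r = flipRate a = v h₁/h`. For `a > 0`, real `y` we prove:
(1) `S′ = −iyD` (chain rule, `∂G_n/∂v = −G_{n+1}`); (2) `D′ = −iyS + 2rD` through the identity
`(vN)′ = −y² G₀(v,y) h` (the `G₁G₁` terms cancel; Bessel's equation `polyaG_ode` at `w = y`,
`w = 0` eliminates `G₂`); (3) `|S| ≤ 2` (`‖G₀(v,y)‖ ≤ h`); (4) `|D(t)| ≤ |y|/(ae^t)`: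
`g = (2i/y) vN = D h²` has `g′ = −2iy G₀(v,y) h` and
`|g′(s)| ≤ 2|y| h(v_s)² ≤ 2|y|h(v_t)²e^{2(v_t−v_s)}` (`h²` is the integrating factor `e^{−2∫r}`;
`h(v′) ≤ e^{v−v′} h(v)`), so a mean-value bound on `[t, T]` gives
`|g(t)| ≤ |g(T)| + |y| h(v_t)²/v_t`, and `g(T) → 0` (`‖G_n‖ ≤ e^{a−v} M_n`); (5) `S(t) → 2`:
`‖S − 2‖ = 2‖G₀(v,y) − h‖/h ≤ |y|(1 + q(a)/a) e^{−t/2}` (`t ≥ 0`) from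
`|e^{iys} − 1| ≤ |ys| ≤ |y|(1 + e^t sinh² s)/(2e^{t/2})`, `∫ sinh² s e^{−v cosh s} ds = h₁/v`
(Bessel at `w = 0`) and `q(v) ≤ q(a)`, `q = besselRatio`. At `y = 0`, `S ≡ 2`, `D ≡ 0`; `hq1`
is not needed. References: M. Kac, Rocky Mountain J. Math. 4 (1974) 497–509 (telegraph process,
`2 × 2` backward system); G. Pólya, Acta Math. 48 (1926) 305–317 (the kernel). Folklore calculus.
-/

noncomputable section

namespace Summit.RiemannHypothesis.RiemannHypothesis.Theorems.LeeYangTelegraph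

open MeasureTheory Filter Topology Complex
open Literature.Probability.LatticeModels Literature.Analysis.Complex.Polya1926

/-- `G_n(x, 0) = M_n(x, 0)` (`= ∫ k_{n,x}`, a non-negative real) as a complex number. [folklore] -/
private lemma polyaG_zero_eq_polyaM (n : ℕ) (x : ℝ) : polyaG n x 0 = ((polyaM n x 0 : ℝ) : ℂ) := by
  rw [polyaM, polyaG_eq, ← integral_complex_ofReal]
  exact integral_congr_ae (Eventually.of_forall fun s => by simp)

/-- `M_n(x, 0) = Re G_n(x, 0)`. [folklore] -/
private lemma polyaM_zero_right (n : ℕ) (x : ℝ) : polyaM n x 0 = (polyaG n x 0).re := by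
  rw [polyaG_zero_eq_polyaM, Complex.ofReal_re]

/-- `‖G_n(x, 0)‖ = Re G_n(x, 0)` (it is a non-negative real). [folklore] -/
private lemma norm_polyaG_zero_right (n : ℕ) (x : ℝ) : ‖polyaG n x 0‖ = (polyaG n x 0).re := by
  rw [polyaG_zero_eq_polyaM, Complex.ofReal_re, Complex.norm_real, Real.norm_eq_abs,
    abs_of_nonneg (polyaM_nonneg n x 0)]

/-- `‖G_n(x, y)‖ ≤ G_n(x, 0)` for real `y` (`|e^{iys}| = 1`). [folklore] -/
private lemma norm_polyaG_ofReal_le {x : ℝ} (hx : 0 < x) (n : ℕ) (y : ℝ) :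
    ‖polyaG n x y‖ ≤ (polyaG n x 0).re := by
  rw [← polyaM_zero_right, polyaM, polyaG_eq, norm_zero]
  refine norm_integral_le_of_norm_le (integrable_polyaKernel_mul_exp hx n 0)
    (Eventually.of_forall fun s => ?_)
  rw [norm_mul, norm_polyaKernel, show I * (y : ℂ) * (s : ℂ) = I * ((y * s : ℝ) : ℂ) by
    push_cast; ring, Complex.norm_exp_I_mul_ofReal, zero_mul, Real.exp_zero]

/-- `d/dt G_n(ae^t, w) = −ae^t · G_{n+1}(ae^t, w)`. [folklore] -/
private lemma hasDerivAt_polyaG_exp {a : ℝ} (ha : 0 < a) (n : ℕ) (w : ℂ) (t : ℝ) :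
    HasDerivAt (fun s : ℝ => polyaG n (a * Real.exp s) w)
      (-(((a * Real.exp t : ℝ) : ℂ) * polyaG (n + 1) (a * Real.exp t) w)) t := by
  have hu : HasDerivAt (fun s : ℝ => a * Real.exp s) (a * Real.exp t) t :=
    (Real.hasDerivAt_exp t).const_mul a
  refine ((hasDerivAt_polyaG (mul_pos ha (Real.exp_pos t)) n w).scomp t hu).congr_deriv ?_
  rw [Complex.real_smul]; ring

/-- The key identity `(v N)′ = −y² G₀(v,y) G₀(v,0)` for `N = G₀(v,y)G₁(v,0) − G₁(v,y)G₀(v,0)`,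
`v = ae^t` (Bessel's equation `polyaG_ode` at `w = y` and `w = 0`). [folklore] -/
private lemma hasDerivAt_vN {a : ℝ} (ha : 0 < a) (y : ℝ) (t : ℝ) :
    HasDerivAt (fun s : ℝ => ((a * Real.exp s : ℝ) : ℂ) *
        (polyaG 0 (a * Real.exp s) y * polyaG 1 (a * Real.exp s) 0 -
          polyaG 1 (a * Real.exp s) y * polyaG 0 (a * Real.exp s) 0))
      (-((y : ℂ) ^ 2 * polyaG 0 (a * Real.exp t) y * polyaG 0 (a * Real.exp t) 0)) t := by
  have hx : 0 < a * Real.exp t := mul_pos ha (Real.exp_pos t)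
  have hv : HasDerivAt (fun s : ℝ => ((a * Real.exp s : ℝ) : ℂ)) ((a * Real.exp t : ℝ) : ℂ) t :=
    ((Real.hasDerivAt_exp t).const_mul a).ofReal_comp
  have key := hv.mul
    (((hasDerivAt_polyaG_exp ha 0 y t).mul (hasDerivAt_polyaG_exp ha 1 0 t)).sub
      ((hasDerivAt_polyaG_exp ha 1 y t).mul (hasDerivAt_polyaG_exp ha 0 0 t)))
  refine key.congr_deriv ?_
  have hODEy := polyaG_ode hx y
  have hODE0 := polyaG_ode hx 0
  simp only [Nat.reduceAdd, Pi.mul_apply, Pi.sub_apply] at hODEy hODE0 ⊢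
  linear_combination
    (polyaG 0 (a * Real.exp t) 0) * hODEy - (polyaG 0 (a * Real.exp t) y) * hODE0

/-- `S′ = −iyD` (`y ≠ 0`). [folklore] -/
private lemma hasDerivAt_solS {a : ℝ} (ha : 0 < a) {y : ℝ} (hy : y ≠ 0) (t : ℝ)
    (hpos : ∀ v : ℝ, 0 < v → 0 < (polyaG 0 v 0).re) :
    HasDerivAt (solS a y) (-(I * y * solD a y t)) t := by
  have hx : 0 < a * Real.exp t := mul_pos ha (Real.exp_pos t)
  have hne : polyaG 0 (a * Real.exp t) 0 ≠ 0 := fun h =>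
    (hpos _ hx).ne' (by rw [h, Complex.zero_re])
  have hy' : (y : ℂ) ≠ 0 := Complex.ofReal_ne_zero.2 hy
  have key := ((hasDerivAt_polyaG_exp ha 0 y t).const_mul (2 : ℂ)).div
    (hasDerivAt_polyaG_exp ha 0 0 t) hne
  show HasDerivAt (fun s => 2 * polyaG 0 (a * Real.exp s) y / polyaG 0 (a * Real.exp s) 0) _ t
  refine key.congr_deriv ?_
  simp only [solD, Nat.reduceAdd]
  field_simp
  ring_nf
  rw [Complex.I_sq]
  ring

/-- `D′ = −iyS + 2rD` (`y ≠ 0`), with `r = v G₁(v,0)/G₀(v,0)` and `(vN)′ = −y² G₀(v,y) G₀(v,0)`.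
[folklore] -/
private lemma hasDerivAt_solD {a : ℝ} (ha : 0 < a) {y : ℝ} (hy : y ≠ 0) (t : ℝ)
    (hpos : ∀ v : ℝ, 0 < v → 0 < (polyaG 0 v 0).re) :
    HasDerivAt (solD a y) (-(I * y * solS a y t) + 2 * (flipRate a t : ℂ) * solD a y t) t := by
  have hx : 0 < a * Real.exp t := mul_pos ha (Real.exp_pos t)
  have hne : polyaG 0 (a * Real.exp t) 0 ≠ 0 := fun h =>
    (hpos _ hx).ne' (by rw [h, Complex.zero_re])
  have hy' : (y : ℂ) ≠ 0 := Complex.ofReal_ne_zero.2 hy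
  have hfun : solD a y = fun s => 2 * I / (y : ℂ) * (((a * Real.exp s : ℝ) : ℂ) *
      (polyaG 0 (a * Real.exp s) y * polyaG 1 (a * Real.exp s) 0 -
        polyaG 1 (a * Real.exp s) y * polyaG 0 (a * Real.exp s) 0)) /
      polyaG 0 (a * Real.exp s) 0 ^ 2 := by
    funext s; simp only [solD]; ring
  have key := ((hasDerivAt_vN ha y t).const_mul (2 * I / (y : ℂ))).div
    ((hasDerivAt_polyaG_exp ha 0 0 t).fun_pow 2) (pow_ne_zero 2 hne)
  have hr : ((flipRate a t : ℝ) : ℂ) =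
      ((a * Real.exp t : ℝ) : ℂ) * polyaG 1 (a * Real.exp t) 0 / polyaG 0 (a * Real.exp t) 0 := by
    rw [flipRate, besselRatio, ← polyaM_zero_right, ← polyaM_zero_right, polyaG_zero_eq_polyaM 1,
      polyaG_zero_eq_polyaM 0]; push_cast; ring
  rw [hr, hfun]
  refine key.congr_deriv ?_
  simp only [solS, Nat.reduceAdd, Nat.cast_ofNat, Nat.add_one_sub_one, pow_one]
  field_simp
  ring

/-- `|S| ≤ 2` (`‖G₀(v, y)‖ ≤ G₀(v, 0)`). [folklore] -/
private lemma norm_solS_le {a : ℝ} (ha : 0 < a) (y t : ℝ)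
    (hpos : ∀ v : ℝ, 0 < v → 0 < (polyaG 0 v 0).re) : ‖solS a y t‖ ≤ 2 := by
  have h1 := norm_polyaG_ofReal_le (mul_pos ha (Real.exp_pos t)) 0 y
  rw [solS, norm_div, norm_mul, Complex.norm_two, norm_polyaG_zero_right,
    div_le_iff₀ (hpos _ (mul_pos ha (Real.exp_pos t)))]
  linarith

/-- The case `y = 0`: `S ≡ 2`. [folklore] -/
private lemma solS_zero_eq {a : ℝ} (ha : 0 < a) (hpos : ∀ v : ℝ, 0 < v → 0 < (polyaG 0 v 0).re) :
    solS a 0 = fun _ => 2 := by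
  funext t
  have hne : polyaG 0 (a * Real.exp t) 0 ≠ 0 := fun h =>
    (hpos _ (mul_pos ha (Real.exp_pos t))).ne' (by rw [h, Complex.zero_re])
  simp only [solS, Complex.ofReal_zero]
  field_simp

/-- Mean-value bound on `[t, T]` against the boundary function `B(s) = K(1 − e^{2(v_t − v_s)})`,
`v_s = ae^s`: if `‖g′(s)‖ ≤ B′(s) = 2K v_s e^{2(v_t − v_s)}` on `[t, T)` then `‖g(T) − g(t)‖ ≤ K`.
[folklore] -/
private lemma norm_sub_le_of_deriv_bound {a K t T : ℝ} (hK : 0 ≤ K) (htT : t ≤ T)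
    {g g' : ℝ → ℂ} (hg : ∀ s, HasDerivAt g (g' s) s) (hb : ∀ s ∈ Set.Ico t T,
      ‖g' s‖ ≤ 2 * K * (a * Real.exp s) * Real.exp (2 * (a * Real.exp t - a * Real.exp s))) :
    ‖g T - g t‖ ≤ K := by
  have hB : ∀ s, HasDerivAt (fun s => K * (1 - Real.exp (2 * (a * Real.exp t - a * Real.exp s))))
      (2 * K * (a * Real.exp s) * Real.exp (2 * (a * Real.exp t - a * Real.exp s))) s := by
    intro s
    have h1 := (((((Real.hasDerivAt_exp s).const_mul a).const_sub (a * Real.exp t)).const_mul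
      (2 : ℝ)).exp.const_sub 1).const_mul K
    refine h1.congr_deriv ?_
    ring
  have key := image_norm_le_of_norm_deriv_right_le_deriv_boundary
    (f := fun s => g s - g t) (f' := g') (a := t) (b := T)
    (B := fun s => K * (1 - Real.exp (2 * (a * Real.exp t - a * Real.exp s))))
    (B' := fun s => 2 * K * (a * Real.exp s) * Real.exp (2 * (a * Real.exp t - a * Real.exp s)))
    (fun s _ => ((hg s).sub_const (g t)).continuousAt.continuousWithinAt)
    (fun s _ => ((hg s).sub_const (g t)).hasDerivWithinAt) (by simp) hB hb
    (Set.right_mem_Icc.2 htT)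
  refine key.trans ?_
  have : 0 ≤ Real.exp (2 * (a * Real.exp t - a * Real.exp T)) := (Real.exp_pos _).le
  nlinarith

/-- `v N(v) → 0` along `v = ae^T → ∞` (from `‖G_n(v, w)‖ ≤ e^{a−v} M_n(a, w)`). [folklore] -/
private lemma tendsto_vN {a : ℝ} (ha : 0 < a) (y : ℝ) :
    Tendsto (fun T : ℝ => ((a * Real.exp T : ℝ) : ℂ) *
      (polyaG 0 (a * Real.exp T) y * polyaG 1 (a * Real.exp T) 0 -
        polyaG 1 (a * Real.exp T) y * polyaG 0 (a * Real.exp T) 0)) atTop (𝓝 0) := by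
  set Kc : ℝ := polyaM 0 a y * polyaM 1 a 0 + polyaM 1 a y * polyaM 0 a 0 with hKc
  have h0 := (tendsto_rpow_mul_exp_neg_mul_atTop_nhds_zero 1 2 two_pos).comp
    (Real.tendsto_exp_atTop.const_mul_atTop ha)
  have h1 : Tendsto (fun T : ℝ => Real.exp (2 * a) * Kc *
      ((a * Real.exp T) ^ (1 : ℝ) * Real.exp (-2 * (a * Real.exp T)))) atTop (𝓝 0) := by
    simpa using h0.const_mul (Real.exp (2 * a) * Kc)
  refine squeeze_zero_norm' ?_ h1
  filter_upwards [eventually_ge_atTop (0 : ℝ)] with T hT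
  have hxT : a ≤ a * Real.exp T := le_mul_of_one_le_right ha.le (Real.one_le_exp hT)
  have hx : 0 < a * Real.exp T := mul_pos ha (Real.exp_pos T)
  rw [Real.rpow_one, norm_mul, Complex.norm_real, Real.norm_eq_abs, abs_of_pos hx]
  have e2 : ∀ (n m : ℕ) (w w' : ℂ), ‖polyaG n (a * Real.exp T) w * polyaG m (a * Real.exp T) w'‖
      ≤ Real.exp (a - a * Real.exp T) ^ 2 * (polyaM n a w * polyaM m a w') := fun n m w w' => by
    rw [norm_mul, sq, mul_mul_mul_comm]
    exact mul_le_mul (norm_polyaG_le ha hxT n w) (norm_polyaG_le ha hxT m w') (norm_nonneg _)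
      (mul_nonneg (Real.exp_pos _).le (polyaM_nonneg n a w))
  have hN : ‖polyaG 0 (a * Real.exp T) y * polyaG 1 (a * Real.exp T) 0 -
      polyaG 1 (a * Real.exp T) y * polyaG 0 (a * Real.exp T) 0‖ ≤
      Real.exp (a - a * Real.exp T) ^ 2 * Kc :=
    (norm_sub_le _ _).trans (by rw [hKc, mul_add]; exact add_le_add (e2 0 1 y 0) (e2 1 0 y 0))
  calc a * Real.exp T * ‖polyaG 0 (a * Real.exp T) y * polyaG 1 (a * Real.exp T) 0 -
          polyaG 1 (a * Real.exp T) y * polyaG 0 (a * Real.exp T) 0‖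
      ≤ a * Real.exp T * (Real.exp (a - a * Real.exp T) ^ 2 * Kc) := by gcongr
    _ = Real.exp (2 * a) * Kc * (a * Real.exp T * Real.exp (-2 * (a * Real.exp T))) := by
        rw [sq, ← Real.exp_add, show a - a * Real.exp T + (a - a * Real.exp T) =
          2 * a + -2 * (a * Real.exp T) by ring, Real.exp_add]
        ring

/-- `|D(t)| ≤ |y|/(ae^t)` (`y ≠ 0`): with `g = (2i/y) v N` one has `D = g/G₀(v,0)²`,
`g′ = −2iy G₀(v,y) G₀(v,0)`, `|g′(s)| ≤ 2|y| G₀(v_t,0)² e^{2(v_t − v_s)}`, so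
`|g(t)| ≤ |g(T)| + |y| G₀(v_t,0)²/v_t` and `g(T) → 0`. [folklore] -/
private lemma norm_solD_le {a : ℝ} (ha : 0 < a) {y : ℝ} (hy : y ≠ 0) (t : ℝ)
    (hpos : ∀ v : ℝ, 0 < v → 0 < (polyaG 0 v 0).re) : ‖solD a y t‖ ≤ |y| / (a * Real.exp t) := by
  have hx : 0 < a * Real.exp t := mul_pos ha (Real.exp_pos t)
  have hpos := hpos _ hx
  have hy' : (y : ℂ) ≠ 0 := Complex.ofReal_ne_zero.2 hy
  set c : ℝ := (polyaG 0 (a * Real.exp t) 0).re with hc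
  set g : ℝ → ℂ := fun s => 2 * I / (y : ℂ) * (((a * Real.exp s : ℝ) : ℂ) *
      (polyaG 0 (a * Real.exp s) y * polyaG 1 (a * Real.exp s) 0 -
        polyaG 1 (a * Real.exp s) y * polyaG 0 (a * Real.exp s) 0)) with hg
  have hgd : ∀ s, HasDerivAt g (2 * I / (y : ℂ) *
      (-((y : ℂ) ^ 2 * polyaG 0 (a * Real.exp s) y * polyaG 0 (a * Real.exp s) 0))) s :=
    fun s => (hasDerivAt_vN ha y s).const_mul _
  set K : ℝ := |y| * c ^ 2 / (a * Real.exp t) with hK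
  have hK0 : 0 ≤ K := by positivity
  have hb : ∀ s, t ≤ s →
      ‖2 * I / (y : ℂ) *
          (-((y : ℂ) ^ 2 * polyaG 0 (a * Real.exp s) y * polyaG 0 (a * Real.exp s) 0))‖ ≤
        2 * K * (a * Real.exp s) * Real.exp (2 * (a * Real.exp t - a * Real.exp s)) := by
    intro s hs
    have hxs : 0 < a * Real.exp s := mul_pos ha (Real.exp_pos s)
    have hts : a * Real.exp t ≤ a * Real.exp s :=
      mul_le_mul_of_nonneg_left (Real.exp_le_exp.2 hs) ha.le
    have hH : ‖polyaG 0 (a * Real.exp s) y‖ ≤ (polyaG 0 (a * Real.exp s) 0).re :=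
      norm_polyaG_ofReal_le hxs 0 y
    have hh :
        (polyaG 0 (a * Real.exp s) 0).re ≤ Real.exp (a * Real.exp t - a * Real.exp s) * c := by
      rw [← norm_polyaG_zero_right, hc, ← polyaM_zero_right]
      exact norm_polyaG_le hx hts 0 0
    have hh0 : 0 ≤ (polyaG 0 (a * Real.exp s) 0).re := (norm_nonneg _).trans hH
    have he :
        Real.exp (a * Real.exp t - a * Real.exp s) * Real.exp (a * Real.exp t - a * Real.exp s) =
          Real.exp (2 * (a * Real.exp t - a * Real.exp s)) := by rw [two_mul, Real.exp_add]
    rw [norm_mul, norm_neg, norm_mul, norm_mul, norm_div, norm_mul, Complex.norm_two,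
      Complex.norm_I, norm_pow, Complex.norm_real, Real.norm_eq_abs, norm_polyaG_zero_right]
    calc 2 * 1 / |y| * (|y| ^ 2 * ‖polyaG 0 (a * Real.exp s) y‖ * (polyaG 0 (a * Real.exp s) 0).re)
        = 2 * |y| * (‖polyaG 0 (a * Real.exp s) y‖ * (polyaG 0 (a * Real.exp s) 0).re) := by
          field_simp
      _ ≤ 2 * |y| * ((Real.exp (a * Real.exp t - a * Real.exp s) * c) *
          (Real.exp (a * Real.exp t - a * Real.exp s) * c)) :=
          mul_le_mul_of_nonneg_left (mul_le_mul (hH.trans hh) hh hh0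
            (mul_nonneg (Real.exp_pos _).le hpos.le)) (by positivity)
      _ = 2 * K * (a * Real.exp t) * Real.exp (2 * (a * Real.exp t - a * Real.exp s)) := by
          rw [hK, ← he]; field_simp
      _ ≤ 2 * K * (a * Real.exp s) * Real.exp (2 * (a * Real.exp t - a * Real.exp s)) := by
          gcongr
  have hgT : ∀ T, t ≤ T → ‖g T - g t‖ ≤ K := fun T hT =>
    norm_sub_le_of_deriv_bound hK0 hT hgd fun s hs => hb s hs.1
  have hnorm : ‖solD a y t‖ = ‖g t‖ / c ^ 2 := by
    rw [show solD a y t = g t / polyaG 0 (a * Real.exp t) 0 ^ 2 by simp only [hg, solD]; ring,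
      norm_div, norm_pow, norm_polyaG_zero_right]
  have h3 : ∀ T, t ≤ T → ‖solD a y t‖ ≤ (‖g T‖ + K) / c ^ 2 := by
    intro T hT
    rw [hnorm]
    gcongr
    calc ‖g t‖ = ‖g T - (g T - g t)‖ := by rw [sub_sub_cancel]
      _ ≤ ‖g T‖ + ‖g T - g t‖ := norm_sub_le _ _
      _ ≤ ‖g T‖ + K := by gcongr; exact hgT T hT
  have hlim : Tendsto (fun T => (‖g T‖ + K) / c ^ 2) atTop
      (𝓝 ((‖(2 * I / (y : ℂ)) * (0 : ℂ)‖ + K) / c ^ 2)) :=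
    ((((tendsto_vN ha y).const_mul (2 * I / (y : ℂ))).norm).add tendsto_const_nhds).div_const _
  have h4 := ge_of_tendsto hlim ((eventually_ge_atTop t).mono fun T hT => h3 T hT)
  calc ‖solD a y t‖ ≤ (‖(2 * I / (y : ℂ)) * (0 : ℂ)‖ + K) / c ^ 2 := h4
    _ = |y| / (a * Real.exp t) := by rw [mul_zero, norm_zero, zero_add, hK]; field_simp

/-- `‖G₀(x, y) − G₀(x, 0)‖ ≤ (|y|/2w) ((1 − w²) g₀ + w² g₂)` for `w > 0`, `g_n = Re G_n(x, 0)`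
(`|e^{iys} − 1| ≤ |ys| ≤ |y|(1 + w² sinh² s)/(2w)` and `k₂ − k₀ = sinh² · k₀`). [folklore] -/
private lemma norm_polyaG_sub_le {x : ℝ} (hx : 0 < x) (y : ℝ) {w : ℝ} (hw : 0 < w) :
    ‖polyaG 0 x y - polyaG 0 x 0‖ ≤
      |y| / (2 * w) * ((1 - w ^ 2) * (polyaG 0 x 0).re + w ^ 2 * (polyaG 2 x 0).re) := by
  have hk : ∀ n, Integrable (polyaKernel n x) := fun n => by
    simpa using integrable_polyaKernel_mul_exp hx n 0
  have hG : ∀ n, (polyaG n x 0).re = ∫ s, polyaKernel n x s := fun n => by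
    rw [← polyaM_zero_right, polyaM]; exact integral_congr_ae (Eventually.of_forall (by simp))
  have hmaj : Integrable (fun s => |y| / (2 * w) *
      ((1 - w ^ 2) * polyaKernel 0 x s + w ^ 2 * polyaKernel 2 x s)) :=
    (((hk 0).const_mul _).add ((hk 2).const_mul _)).const_mul _
  have hint : ∫ s, |y| / (2 * w) * ((1 - w ^ 2) * polyaKernel 0 x s + w ^ 2 * polyaKernel 2 x s)
      = |y| / (2 * w) * ((1 - w ^ 2) * (polyaG 0 x 0).re + w ^ 2 * (polyaG 2 x 0).re) := by
    rw [integral_const_mul, integral_add ((hk 0).const_mul _) ((hk 2).const_mul _),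
      integral_const_mul, integral_const_mul, hG, hG]
  rw [← hint, polyaG_eq, polyaG_eq, ← integral_sub (integrable_polyaKernel_mul_cexp hx 0 y)
    (integrable_polyaKernel_mul_cexp hx 0 0)]
  refine norm_integral_le_of_norm_le hmaj (Eventually.of_forall fun s => ?_)
  have e1 : ‖cexp (I * y * s) - 1‖ ≤ |y| * |s| := by
    have h := Real.norm_exp_I_mul_ofReal_sub_one_le (x := y * s)
    rw [Real.norm_eq_abs, abs_mul] at h
    simpa [mul_assoc] using h
  have hs2 : s ^ 2 ≤ Real.sinh s ^ 2 := by
    refine sq_le_sq.2 ?_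
    rw [Real.abs_sinh]
    exact Real.self_le_sinh_iff.2 (abs_nonneg s)
  have e2 : |s| ≤ (1 + w ^ 2 * Real.sinh s ^ 2) / (2 * w) := by
    rw [le_div_iff₀ (by positivity)]
    nlinarith [sq_nonneg (w * |s| - 1), sq_abs s, hs2, sq_nonneg w]
  have hk2 : polyaKernel 2 x s = Real.sinh s ^ 2 * polyaKernel 0 x s + polyaKernel 0 x s := by
    simp only [polyaKernel, pow_zero, one_mul]
    rw [Real.cosh_sq]; ring
  have hE := polyaKernel_nonneg 0 x s
  rw [mul_zero, zero_mul, Complex.exp_zero, ← mul_sub, norm_mul, norm_polyaKernel, hk2]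
  calc polyaKernel 0 x s * ‖cexp (I * y * s) - 1‖
      ≤ polyaKernel 0 x s * (|y| * ((1 + w ^ 2 * Real.sinh s ^ 2) / (2 * w))) :=
        mul_le_mul_of_nonneg_left (e1.trans (mul_le_mul_of_nonneg_left e2 (abs_nonneg y))) hE
    _ = _ := by field_simp; ring

/-- For `t ≥ 0` (`v = ae^t ≥ a`): `‖S(t) − 2‖ ≤ |y| (1 + q(a)/a) e^{−t/2}`, using
`g₂ − g₀ = g₁/v` (Bessel's equation at `w = 0`) with `w = e^{t/2}` in `norm_polyaG_sub_le`
and `q(v) ≤ q(a)`. [folklore] -/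
private lemma norm_solS_sub_two_le {a : ℝ} (ha : 0 < a) (y : ℝ) {t : ℝ} (ht : 0 ≤ t)
    (hpos : ∀ v : ℝ, 0 < v → 0 < (polyaG 0 v 0).re)
    (hqa : ∀ v : ℝ, a ≤ v → besselRatio v ≤ besselRatio a) :
    ‖solS a y t - 2‖ ≤ |y| * (1 + besselRatio a / a) * Real.exp (-(t / 2)) := by
  have hx : 0 < a * Real.exp t := mul_pos ha (Real.exp_pos t)
  have hq : (polyaG 1 (a * Real.exp t) 0).re / (polyaG 0 (a * Real.exp t) 0).re ≤ besselRatio a :=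
    hqa _ (le_mul_of_one_le_right ha.le (Real.one_le_exp ht))
  have hpos := hpos _ hx
  have hw2 : Real.exp (t / 2) ^ 2 = Real.exp t := by rw [sq, ← Real.exp_add, add_halves]
  have hE := norm_polyaG_sub_le hx y (Real.exp_pos (t / 2))
  have hODE : (a * Real.exp t) ^ 2 * polyaM 2 (a * Real.exp t) 0 -
      a * Real.exp t * polyaM 1 (a * Real.exp t) 0 +
        (0 ^ 2 - (a * Real.exp t) ^ 2) * polyaM 0 (a * Real.exp t) 0 = 0 := by
    have h := polyaG_ode hx 0
    rw [polyaG_zero_eq_polyaM, polyaG_zero_eq_polyaM, polyaG_zero_eq_polyaM] at h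
    exact_mod_cast h
  have h2 : Real.exp t * ((polyaG 2 (a * Real.exp t) 0).re - (polyaG 0 (a * Real.exp t) 0).re) =
      (polyaG 1 (a * Real.exp t) 0).re / a := by
    rw [eq_div_iff ha.ne', ← polyaM_zero_right, ← polyaM_zero_right, ← polyaM_zero_right]
    exact mul_left_cancel₀ hx.ne' (by linear_combination hODE)
  have hI : (1 - Real.exp (t / 2) ^ 2) * (polyaG 0 (a * Real.exp t) 0).re +
      Real.exp (t / 2) ^ 2 * (polyaG 2 (a * Real.exp t) 0).re =
        (polyaG 0 (a * Real.exp t) 0).re + (polyaG 1 (a * Real.exp t) 0).re / a := by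
    rw [hw2]; linear_combination h2
  have hne : polyaG 0 (a * Real.exp t) 0 ≠ 0 := fun h => hpos.ne' (by rw [h, Complex.zero_re])
  have hS : solS a y t - 2 = 2 * (polyaG 0 (a * Real.exp t) y - polyaG 0 (a * Real.exp t) 0) /
      polyaG 0 (a * Real.exp t) 0 := by rw [solS]; field_simp
  rw [hI] at hE
  rw [hS, norm_div, norm_mul, Complex.norm_two, norm_polyaG_zero_right, div_le_iff₀ hpos]
  calc 2 * ‖polyaG 0 (a * Real.exp t) y - polyaG 0 (a * Real.exp t) 0‖
      ≤ 2 * (|y| / (2 * Real.exp (t / 2)) * ((polyaG 0 (a * Real.exp t) 0).re +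
          (polyaG 1 (a * Real.exp t) 0).re / a)) := by gcongr
    _ = |y| * (1 + (polyaG 1 (a * Real.exp t) 0).re / (polyaG 0 (a * Real.exp t) 0).re / a) *
          Real.exp (-(t / 2)) * (polyaG 0 (a * Real.exp t) 0).re := by
        rw [Real.exp_neg]; field_simp
    _ ≤ |y| * (1 + besselRatio a / a) * Real.exp (-(t / 2)) * (polyaG 0 (a * Real.exp t) 0).re := by
        gcongr

/-- `S(t) → 2` as `t → ∞`. [folklore] -/
private lemma tendsto_solS {a : ℝ} (ha : 0 < a) (y : ℝ)
    (hpos : ∀ v : ℝ, 0 < v → 0 < (polyaG 0 v 0).re)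
    (hqa : ∀ v : ℝ, a ≤ v → besselRatio v ≤ besselRatio a) :
    Tendsto (solS a y) atTop (𝓝 2) := by
  rw [tendsto_iff_norm_sub_tendsto_zero]
  have h0 : Tendsto (fun t : ℝ => |y| * (1 + besselRatio a / a) * Real.exp (-(t / 2))) atTop
      (𝓝 0) := by
    have h := Real.tendsto_exp_neg_atTop_nhds_zero.comp (tendsto_id.atTop_div_const two_pos)
    simpa [Function.comp_def] using h.const_mul (|y| * (1 + besselRatio a / a))
  refine squeeze_zero_norm' ?_ h0
  filter_upwards [eventually_ge_atTop (0 : ℝ)] with t ht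
  rw [norm_norm]; exact norm_solS_sub_two_le ha y ht hpos hqa

/-- **The continuum solution of the telegraph backward system.** For `a > 0`, real `y`, and
`S = solS a y`, `D = solD a y`, `r = flipRate a`: `S′ = −iyD`, `D′ = −iyS + 2rD`, `|S| ≤ 2`,
`|D(t)| ≤ |y|/(ae^t)`, and `S(t) → 2` as `t → ∞` (given that `G₀(v,0) > 0`, `G₀(v,0)`, `G₁(v,0)`
are real and `q = besselRatio` is maximal at `a` on `[a, ∞)`; `hq1` is not used). [folklore] -/
theorem stub_solution (a : ℝ) (ha : 0 < a) (y : ℝ)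
    (hre : ∀ v : ℝ, 0 < v → 0 < (polyaG 0 v 0).re ∧ (polyaG 0 v 0).im = 0 ∧ (polyaG 1 v 0).im = 0)
    (hq1 : ∀ v : ℝ, 0 < v → 1 ≤ besselRatio v)
    (hqa : ∀ v : ℝ, a ≤ v → besselRatio v ≤ besselRatio a) :
    (∀ t : ℝ, HasDerivAt (solS a y) (-(I * y * solD a y t)) t) ∧
    (∀ t : ℝ, HasDerivAt (solD a y) (-(I * y * solS a y t) + 2 * (flipRate a t : ℂ) * solD a y t) t) ∧
    (∀ t : ℝ, ‖solS a y t‖ ≤ 2) ∧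
    (∀ t : ℝ, ‖solD a y t‖ ≤ |y| / (a * Real.exp t)) ∧
    Tendsto (solS a y) atTop (𝓝 2) := by
  have _ := hq1
  have hpos : ∀ v : ℝ, 0 < v → 0 < (polyaG 0 v 0).re := fun v hv => (hre v hv).1
  obtain rfl | hy := eq_or_ne y 0
  · rw [solS_zero_eq ha hpos, show solD a 0 = fun _ => 0 from funext fun t => by simp [solD]]
    refine ⟨fun t => ?_, fun t => ?_, fun t => ?_, fun t => ?_, tendsto_const_nhds⟩
    · simpa using hasDerivAt_const t (2 : ℂ)
    · simpa using hasDerivAt_const t (0 : ℂ)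
    · simp
    · simp
  · exact ⟨fun t => hasDerivAt_solS ha hy t hpos, fun t => hasDerivAt_solD ha hy t hpos,
      fun t => norm_solS_le ha y t hpos, fun t => norm_solD_le ha hy t hpos,
      tendsto_solS ha y hpos hqa⟩

end Summit.RiemannHypothesis.RiemannHypothesis.Theorems.LeeYangTelegraph

end
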